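import Mathlib

/-!
# EriceRemainderEnclosureHistoryAutonomyComparisonAgeCompositionStaticChainObserverRatios — (E78c) THE REDUCTION OF THE OBSERVER STEP TO ONE DIMENSION:
# two-sided bounds on the observer ratios of a close pair of scales over ALL older ages (`α_k = S_{k,z}∕S_{k,y} ∈ [z∕y, S_{y+1,z}∕S_{y+1,y}]`,
# `β_k = (y∕z)S_{z,k}∕S_{y,k} ∈ [√(y∕z), (y∕z)S_{z,y+1}∕S_{y,y+1}]`, one partial-sum-ratio lemma), the finite-load step from its first order (the step
# inequality is a QUADRATIC in the new load: `m₁ ≥ 0 ∧ c₁ ≤ λm₁` suffice), and the first-order margin from FOUR SCALAR CORNERS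

Cell `pub-balaban`, β-function sub-cell, BINDER row D4 «RemainderConst leaves for Bałaban's split» (`HOME/BINDER-OWNERS.md`; owner lineage `b2b-balaban-beta-an4`;
this file by co-owner #2 lineage `b2b-balaban-beta-d4-p2`, generation 69), β-FLOW TEAM duty (1), FREEZE (0) honoured (def-free, Mathlib only; (E78a)
`…StaticChainCertificate` and (E78b) `…StaticChainResolvent` are referred to BY NAME, nothing restated).

HONEST FRAMING (page 1, verbatim and binding).  *"Discharging BetaPertH makes Bałaban's UV stability UNCONDITIONAL — a real constructive-QFT result; it is
NOT the continuum limit and NOT the Clay problem."*  THIS FILE DISCHARGES NOTHING OF THE KIND.  Elementary real algebra — finite sums of square roots, one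
quadratic polynomial, affine interpolation — hypotheses of a census, not facts; the age profile of Bałaban's (1.22) limit functional is NOT PRINTED ([I] p. 298;
GAPS G-t4-U2-1∕-2) and NOT asserted.  Row D4 class UNCHANGED (critical-path width 0; instance 0∕1; D4 DISCHARGE NO DATE).  HONEST DEPENDENCY: continuum YM on
T⁴ ⇐ BetaPertH ∧ nine spine estimates (0/9 proved); BetaPertH ⇐ (D1) ∧ (D4) ∧ CAP+tail; G-an2-4 gates asym, D1 and NE2/3/4.

THE POINT (census sense (α); route (N′); README `HOME/b2b-balaban-beta-d4-p2/g69/e78/README.md` §5–§6).  After (E78a)–(E78b) the static closure of the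
window-mass chain over the level-coupled system rests on ONE resolvent inequality (◆) per step (processed ages `P` above a new age `y`, observer `z < y`).
This file reduces (◆) to scalar facts about ONE variable `Ψ = Ψ_yy` per geometry `(y, z)`.  §1–§3: the cross amplifications `Ψ_yz, Ψ_zy, Ψ_zz` are the
`Ψ_yy`-kernel re-weighted by the OBSERVER RATIOS `α_k`, `β_k` of the ages `k ∈ P`, and these lie in explicit intervals whose width is `O(1∕y)` — from a
single lemma on ratios of partial sums with monotone term ratio (`partial_sum_ratio_antitone`) and the two crossed monotonicities of `√(k∕(k+l+1))`
(`charge_ratio_ge`, `charge_ratio_antitone`, `read_ratio_ge`, `read_ratio_antitone`); §4 `sandwich_bounds` transfers them through the non-negative kernel.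
§5 `step_of_quadratic_criterion`: cleared of denominators, (◆) at load `u = x_y ∈ [0, x̂_y)` is `u·Δ(u) ≥ 0` with `Δ` a QUADRATIC whose value at the pole
`u = x̂_y` is `4κΠ(1 − b∕λ)(ω − 1∕(λq)) ≥ 0`; so `Δ ≥ 0` on the whole range as soon as the first-order margin `m₁ = Δ(0)` is `≥ 0` ((◆₁)) and `c₁ ≤ λm₁`
(convex case: linear minorant; concave case: chord) — numerically `c₁ ≤ 0` whenever `P` is loaded and `c₁∕(λm₁) ≤ 0.52` in the light limit, and `(1−dia)∕u`
is monotone in `u` in every play (kit j318510∕16∕18).  §6 `first_order_of_corners`: the minorant of `m₁` obtained from the interval facts, the covariance bound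
((E78b)) and the structural window room `ω ≥ ω_s(Ψ)` ((E78b) `return_amplification_ge_lattice`) is AFFINE in `Ψ_zz` and in `ω` separately, so (◆₁) follows
from its non-negativity at FOUR CORNERS — functions of `Ψ` alone.  NUMERICS OF RECORD (`g69/numerics/curve.py`; README §5): along the structural curve
the corner certificate reproduces the adversarial supremum of (◆) (kit j318356∕7∕8, 978 tasks): `0.9151` at `(y,z) = (513,512)`, `0.9142` at `(257,256)`,
`≤ 0.84` for `y∕z ≥ 5∕4`, `→ κ = 0.775` for `y∕z ≥ 2` — the reductions of this file and (E78b) LOSE NOTHING against the truth.  NOT CLAIMED: the scalar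
certificate itself (`F ≥ 0` at the corners for every `Ψ ≥ 0` and every lattice geometry — the successor's certified-numerics target, README §6); (◆); the
static closure; anything about the flow; MONO; nonlinear; printed.

WHAT IS PROVED ([folklore]; 0 `def`, 0 sorry).  §1 **`partial_sum_ratio_antitone`**, `partial_sum_avg_antitone`.  §2 `summand_nonneg`, `summand_antitone_pos`,
`summand_cross_scale`.  §3 **`charge_ratio_ge`**, **`charge_ratio_antitone`**, **`read_ratio_ge`**, **`read_ratio_antitone`**.  §4 `sandwich_bounds`.  §5
**`step_of_quadratic_criterion`**.  §6 **`first_order_of_corners`**.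
-/
noncomputable section
open Finset

namespace Summit.QuantumFields.BalabanUV.Beta.EriceRemainderEnclosureHistoryAutonomyComparisonAgeCompositionStaticChainObserverRatios

/-! ## §1 Ratios of partial sums of two positive sequences with monotone term ratio -/

variable {u v : ℕ → ℝ}

/-- **PARTIAL-SUM RATIOS INHERIT THE MONOTONICITY OF THE TERM RATIO.**  Two sequences `u, v` whose term ratio is non-increasing in the crossed
form `u_m·v_l ≤ u_l·v_m` for `l ≤ m` (no sign condition is needed in this form).  Then for `k ≤ k'`: `(Σ_{l<k'} u)(Σ_{l<k} v) ≤ (Σ_{l<k} u)(Σ_{l<k'} v)` — the ratio of partial sums `S^u_k∕S^v_k` is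
non-increasing in the length `k` (the tail `[k,k')` of `u` is relatively lighter than the tail of `v`). [folklore] -/
theorem partial_sum_ratio_antitone (hcross : ∀ l m, l ≤ m → u m * v l ≤ u l * v m) {k k' : ℕ} (hkk : k ≤ k') :
    (∑ l ∈ range k', u l) * (∑ l ∈ range k, v l) ≤ (∑ l ∈ range k, u l) * (∑ l ∈ range k', v l) := by
  rw [← sum_range_add_sum_Ico u hkk, ← sum_range_add_sum_Ico v hkk, add_mul, mul_add]
  -- cross terms: `(Σ_{[k,k')} u)(Σ_{<k} v) ≤ (Σ_{<k} u)(Σ_{[k,k')} v)` termwise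
  have hx : (∑ m ∈ Ico k k', u m) * (∑ l ∈ range k, v l) ≤ (∑ l ∈ range k, u l) * (∑ m ∈ Ico k k', v m) := by
    have hL : (∑ m ∈ Ico k k', u m) * (∑ l ∈ range k, v l) = ∑ m ∈ Ico k k', ∑ l ∈ range k, u m * v l := by
      rw [sum_mul]; exact sum_congr rfl fun m _ => mul_sum _ _ _
    have hR : (∑ l ∈ range k, u l) * (∑ m ∈ Ico k k', v m) = ∑ m ∈ Ico k k', ∑ l ∈ range k, u l * v m := by
      rw [mul_sum]; exact sum_congr rfl fun m _ => sum_mul _ _ _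
    rw [hL, hR]
    refine sum_le_sum fun m hm => sum_le_sum fun l hl => ?_
    have hlm : l ≤ m := by
      have h1 := mem_range.mp hl; have h2 := (mem_Ico.mp hm).1; omega
    exact hcross l m hlm
  linarith

/-- The special case `v ≡ 1`: the AVERAGE of a non-increasing sequence is non-increasing in the length,
`k·Σ_{l<k'} u ≤ k'·Σ_{l<k} u` for `k ≤ k'`. [folklore] -/
theorem partial_sum_avg_antitone (hmono : ∀ l m, l ≤ m → u m ≤ u l) {k k' : ℕ} (hkk : k ≤ k') :
    (∑ l ∈ range k', u l) * k ≤ (∑ l ∈ range k, u l) * k' := by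
  have h := partial_sum_ratio_antitone (u := u) (v := fun _ => (1:ℝ)) (fun l m hlm => by simpa using hmono l m hlm) hkk
  simpa using h

/-! ## §2 The read-window summands: the two crossed monotonicities -/

/-- The read-window summand `g_k(l) = √(k∕(k+l+1))` is non-negative. [folklore] -/
theorem summand_nonneg (k : ℝ) (l : ℕ) : 0 ≤ Real.sqrt (k / (k + l + 1)) := Real.sqrt_nonneg _

/-- The summand is non-increasing in the position `l` (`k ≥ 0`). [folklore] -/
theorem summand_antitone_pos {k : ℝ} (hk : 0 ≤ k) {l m : ℕ} (hlm : l ≤ m) :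
    Real.sqrt (k / (k + m + 1)) ≤ Real.sqrt (k / (k + l + 1)) := by
  apply Real.sqrt_le_sqrt
  have hl : (0:ℝ) ≤ l := Nat.cast_nonneg l
  have hlm' : (l:ℝ) ≤ m := by exact_mod_cast hlm
  exact div_le_div_of_nonneg_left hk (by linarith) (by linarith)

/-- **CROSSED MONOTONICITY IN THE SCALE.**  For scales `0 < z ≤ y` and positions `l ≤ m`: `g_z(m)·g_y(l) ≤ g_z(l)·g_y(m)` — the ratio `g_z(l)∕g_y(l) =
√(z(y+l+1)∕(y(z+l+1)))` is non-increasing in `l` (because `(y+l+1)∕(z+l+1)` is). [folklore] -/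
theorem summand_cross_scale {z y : ℝ} (hz : 0 < z) (hzy : z ≤ y) {l m : ℕ} (hlm : l ≤ m) :
    Real.sqrt (z / (z + m + 1)) * Real.sqrt (y / (y + l + 1)) ≤ Real.sqrt (z / (z + l + 1)) * Real.sqrt (y / (y + m + 1)) := by
  have hy : 0 < y := lt_of_lt_of_le hz hzy
  have hl : (0:ℝ) ≤ l := Nat.cast_nonneg l
  have hm : (0:ℝ) ≤ m := Nat.cast_nonneg m
  have hlm' : (l:ℝ) ≤ m := by exact_mod_cast hlm
  rw [← Real.sqrt_mul (div_nonneg hz.le (by linarith)), ← Real.sqrt_mul (div_nonneg hz.le (by linarith))]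
  apply Real.sqrt_le_sqrt
  rw [div_mul_div_comm, div_mul_div_comm, div_le_div_iff₀ (by positivity) (by positivity)]
  -- `z y (z+l+1)(y+m+1) ≤ z y (z+m+1)(y+l+1)` ⟸ `(z+l+1)(y+m+1) ≤ (z+m+1)(y+l+1)` ⟸ `(m−l)(y−z) ≥ 0`
  have hzy0 : 0 ≤ y - z := by linarith
  have key : (z + l + 1) * (y + m + 1) ≤ (z + m + 1) * (y + l + 1) := by nlinarith [mul_nonneg (sub_nonneg.mpr hlm') hzy0]
  have := mul_le_mul_of_nonneg_left key (mul_pos hz (by linarith : (0:ℝ) < y)).le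
  nlinarith [this]

/-! ## §3 The observer ratios of a close pair `z < y` over all older ages: two-sided bounds -/

/-- **THE CHARGE RATIO `α_k = S_{k,z}∕S_{k,y}` IS AT LEAST `z∕y`** (`0 < z ≤ y`, any age `k ≥ 0`): the first `z` reads of age `k` are on average at least
as large as its first `y` reads. [folklore] -/
theorem charge_ratio_ge {k : ℝ} (hk : 0 ≤ k) {z y : ℕ} (hzy : z ≤ y) :
    (∑ l ∈ range y, Real.sqrt (k / (k + l + 1))) * z ≤ (∑ l ∈ range z, Real.sqrt (k / (k + l + 1))) * y :=
  partial_sum_avg_antitone (u := fun l => Real.sqrt (k / (k + l + 1))) (fun _ _ hlm => summand_antitone_pos hk hlm) hzy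

/-- **THE CHARGE RATIO IS NON-INCREASING IN THE AGE**: for `0 < k ≤ k'` and `z ≤ y`, `S_{k',z}·S_{k,y} ≤ S_{k,z}·S_{k',y}` — so over all ages `k ≥ y+1` the
ratio `α_k` lies in `[z∕y, S_{y+1,z}∕S_{y+1,y}]`, an interval of width `O(1∕y)` (README §5: `6·10⁻⁴` at `y = 257`, `z = 256`). [folklore] -/
theorem charge_ratio_antitone {k k' : ℝ} (hk : 0 < k) (hkk : k ≤ k') {z y : ℕ} (hzy : z ≤ y) :
    (∑ l ∈ range z, Real.sqrt (k' / (k' + l + 1))) * (∑ l ∈ range y, Real.sqrt (k / (k + l + 1))) ≤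
      (∑ l ∈ range z, Real.sqrt (k / (k + l + 1))) * (∑ l ∈ range y, Real.sqrt (k' / (k' + l + 1))) := by
  -- apply §1 with `u = g_k`, `v = g_{k'}` (ratio `g_k∕g_{k'}` non-increasing) and lengths `z ≤ y`, then rearrange
  have h := partial_sum_ratio_antitone (u := fun l => Real.sqrt (k / (k + l + 1))) (v := fun l => Real.sqrt (k' / (k' + l + 1)))
    (fun _ _ hlm => summand_cross_scale hk hkk hlm) hzy
  linarith

/-- **THE READ RATIO `S_{z,k}∕S_{y,k}` IS AT LEAST `√(z∕y)`** (`0 < z ≤ y`, any window `k`): termwise `g_z(l) ≥ √(z∕y)·g_y(l)`.  Hence the observer ratio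
`β_k = (y∕z)·S_{z,k}∕S_{y,k} ≥ √(y∕z)`. [folklore] -/
theorem read_ratio_ge {z y : ℝ} (hz : 0 < z) (hzy : z ≤ y) (k : ℕ) :
    Real.sqrt (z / y) * ∑ l ∈ range k, Real.sqrt (y / (y + l + 1)) ≤ ∑ l ∈ range k, Real.sqrt (z / (z + l + 1)) := by
  have hy : 0 < y := lt_of_lt_of_le hz hzy
  rw [mul_sum]
  refine sum_le_sum fun l _ => ?_
  have hl : (0:ℝ) ≤ l := Nat.cast_nonneg l
  rw [← Real.sqrt_mul (div_nonneg hz.le hy.le)]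
  apply Real.sqrt_le_sqrt
  rw [div_mul_div_comm, div_le_div_iff₀ (by positivity) (by positivity)]
  nlinarith [mul_nonneg (by linarith : (0:ℝ) ≤ y - z) hl, mul_nonneg hz.le (by linarith : (0:ℝ) ≤ y - z)]

/-- **THE READ RATIO IS NON-INCREASING IN THE WINDOW**: for `0 < z ≤ y` and `k ≤ k'`, `S_{z,k'}·S_{y,k} ≤ S_{z,k}·S_{y,k'}` — so over all ages `k ≥ y+1` the
observer ratio `β_k` lies in `[√(y∕z), (y∕z)·S_{z,y+1}∕S_{y,y+1}]` (README §5: width `1.3·10⁻³` at `y = 257`, `z = 256`). [folklore] -/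
theorem read_ratio_antitone {z y : ℝ} (hz : 0 < z) (hzy : z ≤ y) {k k' : ℕ} (hkk : k ≤ k') :
    (∑ l ∈ range k', Real.sqrt (z / (z + l + 1))) * (∑ l ∈ range k, Real.sqrt (y / (y + l + 1))) ≤
      (∑ l ∈ range k, Real.sqrt (z / (z + l + 1))) * (∑ l ∈ range k', Real.sqrt (y / (y + l + 1))) :=
  partial_sum_ratio_antitone (u := fun l => Real.sqrt (z / (z + l + 1))) (v := fun l => Real.sqrt (y / (y + l + 1)))
    (fun _ _ hlm => summand_cross_scale hz hzy hlm) hkk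

/-! ## §4 The interval consequences for the cross amplifications (README §5) -/

/-- **INTERVAL BOUNDS TRANSFER THROUGH A NON-NEGATIVE KERNEL.**  Weights `W_{il} ≥ 0`, row ratios `α_i ∈ [α₋, α₊]`, column ratios `β_l ∈ [β₋, β₊]` (all
non-negative).  Then the sandwiched sums obey `α₋·ΣW ≤ ΣWα ≤ α₊·ΣW`, `β₋·ΣW ≤ ΣWβ ≤ β₊·ΣW`, `α₋β₋·ΣW ≤ ΣWαβ ≤ α₊β₊·ΣW`.  With `W_{il} =
(e_y)_iR_{il}φ^y_l`: `Ψ_yz ∈ [α₋,α₊]·Ψ_yy`, `Ψ_zy ∈ [β₋,β₊]·Ψ_yy`, `Ψ_zz ∈ [α₋β₋, α₊β₊]·Ψ_yy` — the linear inputs of the one-dimensional reduction of (◆). [folklore] -/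
theorem sandwich_bounds {n : ℕ} (W : ℕ → ℕ → ℝ) (α β : ℕ → ℝ) (αl αu βl βu : ℝ)
    (hW : ∀ i l, i < n → l < n → 0 ≤ W i l) (hαl : 0 ≤ αl) (hβl : 0 ≤ βl)
    (hα : ∀ i, i < n → αl ≤ α i ∧ α i ≤ αu) (hβ : ∀ l, l < n → βl ≤ β l ∧ β l ≤ βu) :
    αl * (∑ i ∈ range n, ∑ l ∈ range n, W i l) ≤ ∑ i ∈ range n, ∑ l ∈ range n, W i l * α i ∧
    (∑ i ∈ range n, ∑ l ∈ range n, W i l * α i) ≤ αu * ∑ i ∈ range n, ∑ l ∈ range n, W i l ∧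
    βl * (∑ i ∈ range n, ∑ l ∈ range n, W i l) ≤ ∑ i ∈ range n, ∑ l ∈ range n, W i l * β l ∧
    (∑ i ∈ range n, ∑ l ∈ range n, W i l * β l) ≤ βu * ∑ i ∈ range n, ∑ l ∈ range n, W i l ∧
    αl * βl * (∑ i ∈ range n, ∑ l ∈ range n, W i l) ≤ ∑ i ∈ range n, ∑ l ∈ range n, W i l * (α i * β l) ∧
    (∑ i ∈ range n, ∑ l ∈ range n, W i l * (α i * β l)) ≤ αu * βu * ∑ i ∈ range n, ∑ l ∈ range n, W i l := by
  refine ⟨?_, ?_, ?_, ?_, ?_, ?_⟩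
  · rw [mul_sum]; refine sum_le_sum fun i hi => ?_; rw [mul_sum]; refine sum_le_sum fun l hl => ?_
    have := hW i l (mem_range.mp hi) (mem_range.mp hl); nlinarith [(hα i (mem_range.mp hi)).1]
  · rw [mul_sum]; refine sum_le_sum fun i hi => ?_; rw [mul_sum]; refine sum_le_sum fun l hl => ?_
    have := hW i l (mem_range.mp hi) (mem_range.mp hl); nlinarith [(hα i (mem_range.mp hi)).2]
  · rw [mul_sum]; refine sum_le_sum fun i hi => ?_; rw [mul_sum]; refine sum_le_sum fun l hl => ?_
    have := hW i l (mem_range.mp hi) (mem_range.mp hl); nlinarith [(hβ l (mem_range.mp hl)).1]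
  · rw [mul_sum]; refine sum_le_sum fun i hi => ?_; rw [mul_sum]; refine sum_le_sum fun l hl => ?_
    have := hW i l (mem_range.mp hi) (mem_range.mp hl); nlinarith [(hβ l (mem_range.mp hl)).2]
  · rw [mul_sum]; refine sum_le_sum fun i hi => ?_; rw [mul_sum]; refine sum_le_sum fun l hl => ?_
    have hw := hW i l (mem_range.mp hi) (mem_range.mp hl)
    have h1 := (hα i (mem_range.mp hi)).1; have h2 := (hβ l (mem_range.mp hl)).1
    have : αl * βl ≤ α i * β l := mul_le_mul h1 h2 hβl (hαl.trans h1)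
    nlinarith
  · rw [mul_sum]; refine sum_le_sum fun i hi => ?_; rw [mul_sum]; refine sum_le_sum fun l hl => ?_
    have hw := hW i l (mem_range.mp hi) (mem_range.mp hl)
    have h1 := (hα i (mem_range.mp hi)).2; have h2 := (hβ l (mem_range.mp hl)).2
    have h0 : 0 ≤ α i := hαl.trans (hα i (mem_range.mp hi)).1
    have : α i * β l ≤ αu * βu := mul_le_mul h1 h2 (hβl.trans (hβ l (mem_range.mp hl)).1) (h0.trans h1)
    nlinarith


/-! ## §5 The finite-load step from its first order: the step inequality is a quadratic in the new age's load -/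

/-- **THE STEP INEQUALITY (◆) AT EVERY LOAD FROM TWO SCALAR FACTS.**  Letters of (E78a) `observer_step` ∕ README §4: `a = 1 + 2κΨ_zz`, `b = 1 + 2κΨ_yy`,
`ω = 1 − Ω_z`, `θ = θ̄(y∕z)`, `q = y∕z`, `Π = (σ_y(z) + Ψ_yz)(φ_y(z) + Ψ_zy)`, `lam = 2(s_y + Ψ_yy) = 1∕x̂_y > 0`, new load `u = x_y ∈ [0, 1∕lam)`.  Cleared
of denominators, (◆) — `aω − (1−θ)bu ≤ (1 − bu)(ω − u∕q)(a + 4κuΠ∕(1 − lam·u))` — is `u·Δ(u) ≥ 0` with the QUADRATIC `Δ(u) = m₁ − c₁u + c₂u²`,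
`m₁ = 4κΠω − b(aω − 1 + θ) − a∕q` (the first-order margin, (◆₁)), `c₁ = 4κΠ(bω + 1∕q) − lam·b(aω − 1 + θ) − (a∕q)(b + lam)`, `c₂ = (b∕q)(4κΠ − a·lam)`, and
`Δ(1∕lam) = 4κΠ(1 − b∕lam)(ω − 1∕(lam·q)) ≥ 0` (`b ≤ lam`: the chain compounds no faster than the resolvent; `lam·q·ω ≥ 1`: the window mass leaves room).
Hence (◆) holds on the whole load range as soon as **`m₁ ≥ 0` and `c₁ ≤ lam·m₁`** (if `c₂ ≥ 0`: `Δ ≥ m₁ − c₁u ≥ m₁(1 − lam·u)`; if `c₂ ≤ 0`: `Δ` is concave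
and non-negative at both ends).  README §5: `c₁ ≤ 0` in every loaded configuration found and `c₁∕(lam·m₁) ≤ 0.52` in the light limit; `(1−dia)∕u` is
monotone in `u` in every play of kit j318510∕16∕18. [folklore] -/
theorem step_of_quadratic_criterion {a b ω θ q P κ lam u : ℝ}
    (hu0 : 0 ≤ u) (hul : lam * u < 1) (hlam : 0 < lam) (hq : 0 < q) (hκP : 0 ≤ κ * P) (hbl : b ≤ lam) (hω : 1 ≤ lam * q * ω)
    (hm1 : 0 ≤ 4 * κ * P * ω - b * (a * ω - 1 + θ) - a / q)
    (hc1 : 4 * κ * P * (b * ω + 1 / q) - lam * b * (a * ω - 1 + θ) - a / q * (b + lam)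
      ≤ lam * (4 * κ * P * ω - b * (a * ω - 1 + θ) - a / q)) :
    a * ω - (1 - θ) * (b * u) ≤ (1 - b * u) * ((a + 4 * κ * u * P / (1 - lam * u)) * (ω - u / q)) := by
  have hD : 0 < 1 - lam * u := by linarith
  set m1 := 4 * κ * P * ω - b * (a * ω - 1 + θ) - a / q with hm1def
  set c1 := 4 * κ * P * (b * ω + 1 / q) - lam * b * (a * ω - 1 + θ) - a / q * (b + lam) with hc1def
  set c2 := b / q * (4 * κ * P - a * lam) with hc2def
  -- value of the quadratic at the pole `u = 1/lam`
  have hend : m1 - c1 / lam + c2 / lam ^ 2 = 4 * κ * P * (1 - b / lam) * (ω - 1 / (lam * q)) := by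
    rw [hm1def, hc1def, hc2def]; field_simp; ring
  have hend0 : 0 ≤ m1 - c1 / lam + c2 / lam ^ 2 := by
    rw [hend]
    have h1 : 0 ≤ 1 - b / lam := by rw [sub_nonneg, div_le_one hlam]; exact hbl
    have h2 : 0 ≤ ω - 1 / (lam * q) := by
      rw [sub_nonneg, div_le_iff₀ (mul_pos hlam hq)]; linarith
    have : 0 ≤ 4 * κ * P := by linarith
    positivity
  -- the quadratic is non-negative at `u`
  have hquad : 0 ≤ m1 - c1 * u + c2 * u ^ 2 := by
    rcases le_or_gt 0 c2 with hc2 | hc2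
    · -- convex case: drop the square, use `c1 ≤ lam m1`
      have h1 : c1 * u ≤ lam * m1 * u := mul_le_mul_of_nonneg_right hc1 hu0
      nlinarith [mul_nonneg hc2 (sq_nonneg u), mul_nonneg hm1 hD.le]
    · -- concave case: above the chord between `u = 0` and `u = 1/lam`
      have hchord : m1 - c1 * u + c2 * u ^ 2 - ((1 - lam * u) * m1 + lam * u * (m1 - c1 / lam + c2 / lam ^ 2))
          = c2 * u * (u - 1 / lam) := by field_simp; ring
      have hneg : 0 ≤ c2 * u * (u - 1 / lam) := by
        have : u - 1 / lam ≤ 0 := by rw [sub_nonpos, le_div_iff₀ hlam]; linarith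
        have : c2 * u ≤ 0 := mul_nonpos_of_nonpos_of_nonneg hc2.le hu0
        exact mul_nonneg_of_nonpos_of_nonpos this (by linarith)
      nlinarith [mul_nonneg hD.le hm1, mul_nonneg (mul_nonneg hlam.le hu0) hend0]
  -- clear denominators: `(RHS − LHS)·(1 − lam u) = u·Δ(u)`
  have key : (1 - b * u) * (a * (1 - lam * u) + 4 * κ * u * P) * (ω - u / q) - (a * ω - (1 - θ) * (b * u)) * (1 - lam * u)
      = u * (m1 - c1 * u + c2 * u ^ 2) := by
    rw [hm1def, hc1def, hc2def]; ring
  have hrew : a + 4 * κ * u * P / (1 - lam * u) = (a * (1 - lam * u) + 4 * κ * u * P) / (1 - lam * u) :=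
    add_div' _ _ _ hD.ne'
  rw [hrew, show (1 - b * u) * ((a * (1 - lam * u) + 4 * κ * u * P) / (1 - lam * u) * (ω - u / q))
      = ((1 - b * u) * (a * (1 - lam * u) + 4 * κ * u * P) * (ω - u / q)) / (1 - lam * u) by ring]
  rw [le_div_iff₀ hD]
  nlinarith [key, mul_nonneg hu0 hquad]


/-! ## §6 The first-order margin from four scalar corners -/

/-- **CORNER REDUCTION OF THE FIRST-ORDER STEP (◆₁).**  Actual resolvent scalars of a step: `Ψ = Ψ_yy ≥ 0`, `Pzz = Ψ_zz`, `Pyz = Ψ_yz`, `Pzy = Ψ_zy`,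
`ω = 1 − Ω_z`; interval facts from `sandwich_bounds` (`α₋Ψ ≤ Pyz`, `β₋Ψ ≤ Pzy`, `lo ≤ Pzz ≤ hi`), a product fact `Ψ·Pzz − Δ·Ψ² ≤ Pyz·Pzy` (from (E78b)
`covariance_bound` with `Δ = ΔαΔβ`, or crudely `Δ = α₊β₊ − α₋β₋`), and the window room `ω_s ≤ ω ≤ 1` (from the structural lemma, `Ω_z ≤ Ω_s = 1 − ω_s`).  The
minorant `F(P, w) := 4κw(σφ + σβ₋Ψ + φα₋Ψ + ΨP − ΔΨ²) − (1+2κΨ)((1+2κP)w − 1 + θ) − (1+2κP)∕q` is AFFINE in `P` and in `w` separately, so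
**`m₁ ≥ 0` follows from `F ≥ 0` at the four corners `(P, w) ∈ {lo, hi} × {ω_s, 1}`** — the one-dimensional certificate of README §5 (a function of `Ψ` alone
along the structural curve, per geometry `(y, z)`; its supremum reproduces the adversarial `0.915`). [folklore] -/
theorem first_order_of_corners {Ψ Pzz Pyz Pzy ω ωs lo hi αl βl Δ κ σ φ θ q : ℝ}
    (hκ : 0 ≤ κ) (hσ : 0 ≤ σ) (hφ : 0 ≤ φ) (hΨ : 0 ≤ Ψ) (hαl : 0 ≤ αl) (hβl : 0 ≤ βl)
    (hyz : αl * Ψ ≤ Pyz) (hzy : βl * Ψ ≤ Pzy) (hlo : lo ≤ Pzz) (hhi : Pzz ≤ hi)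
    (hprod : Ψ * Pzz - Δ * Ψ ^ 2 ≤ Pyz * Pzy) (hωs : ωs ≤ ω) (hω1 : ω ≤ 1) (hωs0 : 0 ≤ ωs)
    (hF : ∀ P w, (P = lo ∨ P = hi) → (w = ωs ∨ w = 1) →
      0 ≤ 4 * κ * w * (σ * φ + σ * βl * Ψ + φ * αl * Ψ + Ψ * P - Δ * Ψ ^ 2) - (1 + 2 * κ * Ψ) * ((1 + 2 * κ * P) * w - 1 + θ) - (1 + 2 * κ * P) / q) :
    0 ≤ 4 * κ * (σ + Pyz) * (φ + Pzy) * ω - (1 + 2 * κ * Ψ) * ((1 + 2 * κ * Pzz) * ω - 1 + θ) - (1 + 2 * κ * Pzz) / q := by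
  have hω0 : 0 ≤ ω := hωs0.trans hωs
  -- (i) the true right side dominates the minorant at `(Pzz, ω)`
  have hPyz0 : 0 ≤ Pyz := le_trans (mul_nonneg hαl hΨ) hyz
  have hPzy0 : 0 ≤ Pzy := le_trans (mul_nonneg hβl hΨ) hzy
  have hR : 4 * κ * ω * (σ * φ + σ * βl * Ψ + φ * αl * Ψ + Ψ * Pzz - Δ * Ψ ^ 2) ≤ 4 * κ * (σ + Pyz) * (φ + Pzy) * ω := by
    have h1 : σ * βl * Ψ ≤ σ * Pzy := by rw [mul_assoc]; exact mul_le_mul_of_nonneg_left hzy hσ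
    have h2 : φ * αl * Ψ ≤ φ * Pyz := by rw [mul_assoc]; exact mul_le_mul_of_nonneg_left hyz hφ
    have h3 : σ * φ + σ * βl * Ψ + φ * αl * Ψ + Ψ * Pzz - Δ * Ψ ^ 2 ≤ (σ + Pyz) * (φ + Pzy) := by nlinarith
    have h4 : 0 ≤ 4 * κ * ω := by positivity
    nlinarith [mul_le_mul_of_nonneg_left h3 h4]
  -- (ii) the minorant is affine in `P`: at `(Pzz, w)` it is a convex combination of its values at `lo` and `hi`
  have hFP : ∀ w, (w = ωs ∨ w = 1) → 0 ≤ 4 * κ * w * (σ * φ + σ * βl * Ψ + φ * αl * Ψ + Ψ * Pzz - Δ * Ψ ^ 2)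
      - (1 + 2 * κ * Ψ) * ((1 + 2 * κ * Pzz) * w - 1 + θ) - (1 + 2 * κ * Pzz) / q := by
    intro w hw
    have hFlo := hF lo w (Or.inl rfl) hw
    have hFhi := hF hi w (Or.inr rfl) hw
    rcases eq_or_lt_of_le (hlo.trans hhi) with heq | hlt
    · -- degenerate interval
      have : Pzz = lo := le_antisymm (heq ▸ hhi) hlo
      rw [this]; exact hFlo
    · -- `Pzz = (1−t) lo + t hi` with `t = (Pzz − lo)/(hi − lo) ∈ [0,1]`; the expression is affine in `P`
      have ht0 : 0 ≤ (Pzz - lo) / (hi - lo) := div_nonneg (by linarith) (by linarith)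
      have ht1 : 0 ≤ (hi - Pzz) / (hi - lo) := div_nonneg (by linarith) (by linarith)
      have hsum : (hi - Pzz) / (hi - lo) + (Pzz - lo) / (hi - lo) = 1 := by
        rw [← add_div, div_eq_one_iff_eq (by linarith)]; ring
      have hP : (hi - Pzz) / (hi - lo) * lo + (Pzz - lo) / (hi - lo) * hi = Pzz := by
        field_simp; ring
      have key : 4 * κ * w * (σ * φ + σ * βl * Ψ + φ * αl * Ψ + Ψ * Pzz - Δ * Ψ ^ 2)
          - (1 + 2 * κ * Ψ) * ((1 + 2 * κ * Pzz) * w - 1 + θ) - (1 + 2 * κ * Pzz) / q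
        = (hi - Pzz) / (hi - lo) * (4 * κ * w * (σ * φ + σ * βl * Ψ + φ * αl * Ψ + Ψ * lo - Δ * Ψ ^ 2)
            - (1 + 2 * κ * Ψ) * ((1 + 2 * κ * lo) * w - 1 + θ) - (1 + 2 * κ * lo) / q)
          + (Pzz - lo) / (hi - lo) * (4 * κ * w * (σ * φ + σ * βl * Ψ + φ * αl * Ψ + Ψ * hi - Δ * Ψ ^ 2)
            - (1 + 2 * κ * Ψ) * ((1 + 2 * κ * hi) * w - 1 + θ) - (1 + 2 * κ * hi) / q) := by
        have hne : hi - lo ≠ 0 := by linarith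
        field_simp
        ring
      rw [key]
      exact add_nonneg (mul_nonneg ht1 hFlo) (mul_nonneg ht0 hFhi)
  -- (iii) the minorant is affine in `w`: at `ω ∈ [ωs, 1]` it is a convex combination of its values at `ωs` and `1`
  have hFω : 0 ≤ 4 * κ * ω * (σ * φ + σ * βl * Ψ + φ * αl * Ψ + Ψ * Pzz - Δ * Ψ ^ 2)
      - (1 + 2 * κ * Ψ) * ((1 + 2 * κ * Pzz) * ω - 1 + θ) - (1 + 2 * κ * Pzz) / q := by
    have hA := hFP ωs (Or.inl rfl)
    have hB := hFP 1 (Or.inr rfl)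
    rcases eq_or_lt_of_le (hωs.trans hω1) with heq | hlt
    · have : ω = ωs := le_antisymm (heq ▸ hω1) hωs
      rw [this]; exact hA
    · have ht0 : 0 ≤ (ω - ωs) / (1 - ωs) := div_nonneg (by linarith) (by linarith)
      have ht1 : 0 ≤ (1 - ω) / (1 - ωs) := div_nonneg (by linarith) (by linarith)
      have key : 4 * κ * ω * (σ * φ + σ * βl * Ψ + φ * αl * Ψ + Ψ * Pzz - Δ * Ψ ^ 2)
          - (1 + 2 * κ * Ψ) * ((1 + 2 * κ * Pzz) * ω - 1 + θ) - (1 + 2 * κ * Pzz) / q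
        = (1 - ω) / (1 - ωs) * (4 * κ * ωs * (σ * φ + σ * βl * Ψ + φ * αl * Ψ + Ψ * Pzz - Δ * Ψ ^ 2)
            - (1 + 2 * κ * Ψ) * ((1 + 2 * κ * Pzz) * ωs - 1 + θ) - (1 + 2 * κ * Pzz) / q)
          + (ω - ωs) / (1 - ωs) * (4 * κ * 1 * (σ * φ + σ * βl * Ψ + φ * αl * Ψ + Ψ * Pzz - Δ * Ψ ^ 2)
            - (1 + 2 * κ * Ψ) * ((1 + 2 * κ * Pzz) * 1 - 1 + θ) - (1 + 2 * κ * Pzz) / q) := by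
        have hne : 1 - ωs ≠ 0 := by linarith
        field_simp
        ring
      rw [key]
      exact add_nonneg (mul_nonneg ht1 hA) (mul_nonneg ht0 hB)
  linarith

end Summit.QuantumFields.BalabanUV.Beta.EriceRemainderEnclosureHistoryAutonomyComparisonAgeCompositionStaticChainObserverRatios

end
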